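import Mathlib
import HarnessLib
import Summits.NavierStokesRegularity.NavierStokesRegularity.Theorems.PoloidalWindowDoorLrcModEntireMorseLevelRays

/-!
# Route `PoloidalWindowDoor`, crux `PoloidalWindowRigidity` (stmt-19708) / item `LrcModEntire` (stmt-20428), ideator line `thread_axis`
# (ns-idea-8) — stub S7′-M `stub_morseLevelPackage`, helper II: THE RADIAL ROOT AND THE COVERING CURVE OF A NEAR-TOP LEVEL CIRCLE

Seat ns-poloidal-K2-p2 g10 (LEAD-lineage on 19708; file `--supports`).  For `g : ℝ³ → ℝ` of class `C²`, horizontally concave on a closed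
ball `B̄(0,δ)` (`D²g(y)(e,e) < 0` for horizontal unit `e`), a centre `o`, a length `L > 0` with all horizontal rays `o + t•u(θ)`,
`t ∈ [0,L]`, inside the ball, and a level `c` with `g o > c > g(o + L•u(θ))` for every direction `u(θ) = (cos θ, sin θ, 0)`:

* `exists_radialRoot` — on every ray there is a UNIQUE `rad θ ∈ (0,L)` with `g(o + rad θ • u θ) = c`; there the radial slope is negative,
  `g > c` before and `g < c` after it (helper I `ray_crossing`);
* `differentiableAt_radialRoot` — `rad` is differentiable (Mathlib's bivariate implicit function theorem `implicitFunctionOfBivariate` at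
  `(θ₀, rad θ₀)`: the `t`-partial is the non-zero radial slope; the implicit function agrees with `rad` near `θ₀` by uniqueness of the root);
* `exists_levelCurve` — the covering curve `σ θ = o + rad θ • u θ`: differentiable with HORIZONTAL velocity `σ'`, `g ∘ σ ≡ c`,
  `dg(σ θ)(σ' θ) = 0`, `∇ₕ g(σ θ) ≠ 0`;
* `exists_angle_of_horizontal` — polar form of a non-zero horizontal vector (`w = ‖w‖ • u θ`), for the surjectivity of `σ` onto the
  level circle.

WHAT THIS IS NOT: not a claim about Navier–Stokes; multivariable calculus (bears_on LADDER-NS N0 via crux 19708 / item 20428, thread_axis S7′-M). [folklore]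
-/

noncomputable section

-- the summit and its single sub-problem share the name (CONVENTIONS §1), as in every Theorems file
set_option linter.dupNamespace false

namespace Summit.NavierStokesRegularity.NavierStokesRegularity.Theorems.PoloidalWindowDoorLrcModEntireMorseLevelRadial

open Set Function Filter Topology Metric
open Summit.NavierStokesRegularity.NavierStokesRegularity.Theorems.PoloidalWindowDoorLrcModEntireMorseLevelRays

variable {g : EuclideanSpace ℝ (Fin 3) → ℝ}

/-! ### The horizontal direction field `u θ = (cos θ, sin θ, 0)` -/

section Direction

variable {u : ℝ → EuclideanSpace ℝ (Fin 3)}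
  (hu : u = fun θ => Real.cos θ • EuclideanSpace.single 0 1 + Real.sin θ • EuclideanSpace.single 1 1)
include hu

/-- `u θ` is horizontal. [folklore] -/
theorem dir_apply_two (θ : ℝ) : u θ 2 = 0 := by
  rw [hu]; simp

/-- The components of `u θ`. [folklore] -/
theorem dir_apply_zero_one (θ : ℝ) : u θ 0 = Real.cos θ ∧ u θ 1 = Real.sin θ := by
  rw [hu]; simp

/-- `‖u θ‖ = 1`. [folklore] -/
theorem norm_dir (θ : ℝ) : ‖u θ‖ = 1 := by
  have h0 := (dir_apply_zero_one hu θ).1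
  have h1 := (dir_apply_zero_one hu θ).2
  have h2 := dir_apply_two hu θ
  rw [EuclideanSpace.norm_eq, Fin.sum_univ_three, h0, h1, h2]
  simp [Real.cos_sq_add_sin_sq]

/-- `u` is differentiable with the horizontal velocity `u' θ = (−sin θ, cos θ, 0)`. [folklore] -/
theorem hasDerivAt_dir (θ : ℝ) :
    HasDerivAt u (-Real.sin θ • EuclideanSpace.single 0 1 + Real.cos θ • EuclideanSpace.single 1 1) θ := by
  rw [hu]
  exact ((Real.hasDerivAt_cos θ).smul_const _).add ((Real.hasDerivAt_sin θ).smul_const _)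

/-- `dg(y)(u θ) = cos θ ∂₀g(y) + sin θ ∂₁g(y)`. [folklore] -/
theorem fderiv_apply_dir (y : EuclideanSpace ℝ (Fin 3)) (θ : ℝ) :
    fderiv ℝ g y (u θ) = Real.cos θ * fderiv ℝ g y (EuclideanSpace.single 0 1) + Real.sin θ * fderiv ℝ g y (EuclideanSpace.single 1 1) := by
  rw [hu]
  simp only [map_add, map_smul, smul_eq_mul]

end Direction

/-- The velocity `u' θ = (−sin θ, cos θ, 0)` of the direction field is horizontal. [folklore] -/
theorem dir_deriv_apply_two (θ : ℝ) :
    (-Real.sin θ • EuclideanSpace.single 0 1 + Real.cos θ • EuclideanSpace.single 1 1 : EuclideanSpace ℝ (Fin 3)) 2 = 0 := by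
  simp

/-- `(x ↦ x) • d` evaluated at `1`: `(d • 1) 1 = d` in `ℝ →L[ℝ] ℝ`. [folklore] -/
theorem smul_one_clm_apply_one (d : ℝ) : (d • (1 : ℝ →L[ℝ] ℝ)) 1 = d := by
  simp

/-! ### Polar form of horizontal vectors -/

/-- **Polar form**: a non-zero horizontal vector is `‖w‖ • (cos θ, sin θ, 0)` for some angle `θ`. [folklore] -/
theorem exists_angle_of_horizontal {w : EuclideanSpace ℝ (Fin 3)} (hw2 : w 2 = 0) (hw : w ≠ 0) :
    ∃ θ : ℝ, w = ‖w‖ • (Real.cos θ • EuclideanSpace.single 0 1 + Real.sin θ • EuclideanSpace.single 1 1 :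
      EuclideanSpace ℝ (Fin 3)) := by
  set z : ℂ := ⟨w 0, w 1⟩ with hz
  have hnw : ‖w‖ = Real.sqrt (w 0 ^ 2 + w 1 ^ 2) := by
    rw [EuclideanSpace.norm_eq, Fin.sum_univ_three, hw2]
    simp [sq_abs]
  have hnz : ‖z‖ = ‖w‖ := by
    rw [hnw, Complex.norm_def, Complex.normSq_apply, hz]
    ring_nf
  have hz0 : z ≠ 0 := by
    intro h
    apply hw
    have h0 : w 0 = 0 := by simpa [hz] using congrArg Complex.re h
    have h1 : w 1 = 0 := by simpa [hz] using congrArg Complex.im h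
    ext i
    fin_cases i <;> simp [h0, h1, hw2]
  have hn0 : ‖w‖ ≠ 0 := by rw [← hnz]; exact norm_ne_zero_iff.2 hz0
  refine ⟨Complex.arg z, ?_⟩
  have hc : Real.cos (Complex.arg z) = w 0 / ‖w‖ := by rw [Complex.cos_arg hz0, hnz]
  have hs : Real.sin (Complex.arg z) = w 1 / ‖w‖ := by rw [Complex.sin_arg, hnz]
  ext i
  fin_cases i
  · simp [hc, mul_div_cancel₀ _ hn0]
  · simp [hs, mul_div_cancel₀ _ hn0]
  · simp [hw2]

/-! ### The radial root -/

section Radial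

variable {u : ℝ → EuclideanSpace ℝ (Fin 3)} {δ L c : ℝ} {o : EuclideanSpace ℝ (Fin 3)}
  (hg : ContDiff ℝ 2 g)
  (hu : u = fun θ => Real.cos θ • EuclideanSpace.single 0 1 + Real.sin θ • EuclideanSpace.single 1 1)
  (hL : 0 < L)
  (hconc : ∀ y ∈ closedBall (0 : EuclideanSpace ℝ (Fin 3)) δ, ∀ e : EuclideanSpace ℝ (Fin 3),
    e 2 = 0 → ‖e‖ = 1 → fderiv ℝ (fderiv ℝ g) y e e < 0)
  (hball : ∀ θ, ∀ t ∈ Icc 0 L, o + t • u θ ∈ closedBall (0 : EuclideanSpace ℝ (Fin 3)) δ)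
  (hc0 : c < g o) (hcL : ∀ θ, g (o + L • u θ) < c)
include hg hu hL hconc hball hc0 hcL

/-- **The radial root.**  On every horizontal ray from `o` there is a unique `rad θ ∈ (0,L)` with `g(o + rad θ • u θ) = c`; the radial
slope there is negative, `g > c` on `[0, rad θ)` and `g < c` on `(rad θ, L]`. [folklore] -/
theorem exists_radialRoot :
    ∃ rad : ℝ → ℝ, (∀ θ, rad θ ∈ Ioo 0 L) ∧ (∀ θ, g (o + rad θ • u θ) = c) ∧
      (∀ θ, fderiv ℝ g (o + rad θ • u θ) (u θ) < 0) ∧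
      (∀ θ, ∀ t ∈ Icc 0 L, g (o + t • u θ) = c → t = rad θ) ∧
      (∀ θ, ∀ t ∈ Icc 0 L, t < rad θ → c < g (o + t • u θ)) ∧
      (∀ θ, ∀ t ∈ Icc 0 L, rad θ < t → g (o + t • u θ) < c) := by
  have hgd : Differentiable ℝ g := hg.differentiable two_ne_zero
  have key : ∀ θ, ∃ r ∈ Ioo 0 L, g (o + r • u θ) = c ∧ fderiv ℝ g (o + r • u θ) (u θ) < 0 ∧
      (∀ t ∈ Icc 0 L, g (o + t • u θ) = c → t = r) ∧
      (∀ t ∈ Icc 0 L, t < r → c < g (o + t • u θ)) ∧ (∀ t ∈ Icc 0 L, r < t → g (o + t • u θ) < c) := by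
    intro θ
    have hneg : ∀ t ∈ Icc 0 L, fderiv ℝ (fun x => fderiv ℝ g x (u θ)) (o + t • u θ) (u θ) < 0 := by
      intro t ht
      rw [fderiv_fderiv_apply_const hg]
      exact hconc _ (hball θ t ht) _ (dir_apply_two hu θ) (norm_dir hu θ)
    have h0 : c < g (o + (0 : ℝ) • u θ) := by simpa using hc0
    exact ray_crossing hL (fun t => hasDerivAt_ray hgd o (u θ) t) (fun t => hasDerivAt_ray_deriv hg o (u θ) t)
      hneg h0 (hcL θ)
  choose rad hrad using key
  exact ⟨rad, fun θ => (hrad θ).1, fun θ => (hrad θ).2.1, fun θ => (hrad θ).2.2.1, fun θ => (hrad θ).2.2.2.1,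
    fun θ => (hrad θ).2.2.2.2.1, fun θ => (hrad θ).2.2.2.2.2⟩

omit hL hconc hball hc0 hcL in
/-- **The radial root is differentiable** (implicit function theorem at `(θ₀, rad θ₀)` for `(θ,t) ↦ g(o + t•u θ)`, whose `t`-partial is
the non-zero radial slope; the implicit function coincides with `rad` near `θ₀` by uniqueness of the root in `(0,L)`). [folklore] -/
theorem differentiableAt_radialRoot {rad : ℝ → ℝ} (hradI : ∀ θ, rad θ ∈ Ioo 0 L) (hradc : ∀ θ, g (o + rad θ • u θ) = c)
    (hslope : ∀ θ, fderiv ℝ g (o + rad θ • u θ) (u θ) ≠ 0)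
    (huniq : ∀ θ, ∀ t ∈ Icc 0 L, g (o + t • u θ) = c → t = rad θ) (θ₀ : ℝ) :
    DifferentiableAt ℝ rad θ₀ := by
  have hgd : Differentiable ℝ g := hg.differentiable two_ne_zero
  have hgc1 : Continuous (fderiv ℝ g) := hg.continuous_fderiv (by norm_num)
  set r₀ : ℝ := rad θ₀ with hr₀
  -- the bivariate function and its partial derivatives
  set f : ℝ → ℝ → ℝ := fun θ t => g (o + t • u θ) with hf
  set u' : ℝ → EuclideanSpace ℝ (Fin 3) := fun θ => -Real.sin θ • EuclideanSpace.single 0 1 + Real.cos θ • EuclideanSpace.single 1 1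
    with hu'
  set f₁ : ℝ → ℝ → ℝ →L[ℝ] ℝ := fun θ t => (fderiv ℝ g (o + t • u θ) (t • u' θ)) • (1 : ℝ →L[ℝ] ℝ) with hf₁
  set f₂ : ℝ → ℝ → ℝ →L[ℝ] ℝ := fun θ t => (fderiv ℝ g (o + t • u θ) (u θ)) • (1 : ℝ →L[ℝ] ℝ) with hf₂
  have huc : Continuous u := by rw [hu]; fun_prop
  have hu'c : Continuous u' := by rw [hu']; fun_prop
  have hud : ∀ θ, HasDerivAt u (u' θ) θ := fun θ => by rw [hu']; exact hasDerivAt_dir hu θ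
  -- partial derivative in `θ`
  have df₁ : ∀ᶠ v in 𝓝 (θ₀, r₀), HasFDerivAt (f · v.2) (f₁ v.1 v.2) v.1 := Filter.Eventually.of_forall fun v => by
    have h1 : HasDerivAt (fun θ => o + v.2 • u θ) (v.2 • u' v.1) v.1 := by
      simpa using ((hud v.1).const_smul v.2).const_add o
    have h2 : HasDerivAt (fun θ => g (o + v.2 • u θ)) (fderiv ℝ g (o + v.2 • u v.1) (v.2 • u' v.1)) v.1 :=
      (hgd _).hasFDerivAt.comp_hasDerivAt v.1 h1
    rw [hasFDerivAt_iff_hasDerivAt, hf₁, smul_one_clm_apply_one]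
    exact h2
  -- partial derivative in `t`
  have df₂ : ∀ᶠ v in 𝓝 (θ₀, r₀), HasFDerivAt (f v.1 ·) (f₂ v.1 v.2) v.2 := Filter.Eventually.of_forall fun v => by
    rw [hasFDerivAt_iff_hasDerivAt, hf₂, smul_one_clm_apply_one]
    exact hasDerivAt_ray hgd o (u v.1) v.2
  -- continuity of the partials
  have cf₁ : ContinuousAt ↿f₁ (θ₀, r₀) := by
    have ha : Continuous fun q : ℝ × ℝ => o + q.2 • u q.1 := by fun_prop
    have hb : Continuous fun q : ℝ × ℝ => q.2 • u' q.1 := by fun_prop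
    have hs : Continuous fun q : ℝ × ℝ => fderiv ℝ g (o + q.2 • u q.1) (q.2 • u' q.1) := (hgc1.comp ha).clm_apply hb
    have hc : Continuous fun q : ℝ × ℝ => f₁ q.1 q.2 := by
      simp only [hf₁]
      exact hs.smul continuous_const
    exact hc.continuousAt
  have cf₂ : ContinuousAt ↿f₂ (θ₀, r₀) := by
    have ha : Continuous fun q : ℝ × ℝ => o + q.2 • u q.1 := by fun_prop
    have hb : Continuous fun q : ℝ × ℝ => u q.1 := by fun_prop
    have hs : Continuous fun q : ℝ × ℝ => fderiv ℝ g (o + q.2 • u q.1) (u q.1) := (hgc1.comp ha).clm_apply hb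
    have hc : Continuous fun q : ℝ × ℝ => f₂ q.1 q.2 := by
      simp only [hf₂]
      exact hs.smul continuous_const
    exact hc.continuousAt
  -- invertibility of the `t`-partial at `(θ₀, r₀)`
  have hd0 : fderiv ℝ g (o + r₀ • u θ₀) (u θ₀) ≠ 0 := hslope θ₀
  have hinv : (f₂ (θ₀, r₀).1 (θ₀, r₀).2).IsInvertible := by
    refine ⟨ContinuousLinearEquiv.unitsEquivAut ℝ (Units.mk0 _ hd0), ?_⟩
    ext
    simp [hf₂, mul_comm]
  -- the implicit function
  set ψ := implicitFunctionOfBivariate df₁ df₂ cf₁ cf₂ hinv with hψ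
  have hψt : Tendsto ψ (𝓝 θ₀) (𝓝 r₀) := tendsto_implicitFunctionOfBivariate df₁ df₂ cf₁ cf₂ hinv
  have hψf : ∀ᶠ θ in 𝓝 θ₀, f θ (ψ θ) = f θ₀ r₀ := eventually_apply_implicitFunctionOfBivariate df₁ df₂ cf₁ cf₂ hinv
  have hψd : DifferentiableAt ℝ ψ θ₀ :=
    (hasStrictFDerivAt_implicitFunctionOfBivariate df₁ df₂ cf₁ cf₂ hinv).hasFDerivAt.differentiableAt
  -- near `θ₀` the implicit function is the radial root
  have hIoo : ∀ᶠ θ in 𝓝 θ₀, ψ θ ∈ Ioo 0 L := hψt (isOpen_Ioo.mem_nhds (hradI θ₀))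
  have heq : rad =ᶠ[𝓝 θ₀] ψ := by
    filter_upwards [hIoo, hψf] with θ h1 h2
    have h3 : g (o + ψ θ • u θ) = c := by
      have : f θ₀ r₀ = c := hradc θ₀
      rw [← this]; exact h2
    exact (huniq θ (ψ θ) (Ioo_subset_Icc_self h1) h3).symm
  exact hψd.congr_of_eventuallyEq heq

/-- **The covering curve of the level circle.**  With the radial root `rad`, the curve `σ θ = o + rad θ • u θ` is differentiable with
horizontal velocity, runs inside the level set `{g = c}`, its velocity is tangent to the levels (`dg(σ)(σ') = 0`), and the horizontal
gradient of `g` does not vanish along it. [folklore] -/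
theorem exists_levelCurve :
    ∃ (rad : ℝ → ℝ) (σ σ' : ℝ → EuclideanSpace ℝ (Fin 3)),
      (∀ θ, rad θ ∈ Ioo 0 L) ∧ (∀ θ, σ θ = o + rad θ • u θ) ∧
      (∀ θ, HasDerivAt σ (σ' θ) θ) ∧ (∀ θ, σ' θ 2 = 0) ∧ (∀ θ, g (σ θ) = c) ∧
      (∀ θ, fderiv ℝ g (σ θ) (σ' θ) = 0) ∧
      (∀ θ, fderiv ℝ g (σ θ) (EuclideanSpace.single 0 1) ≠ 0 ∨ fderiv ℝ g (σ θ) (EuclideanSpace.single 1 1) ≠ 0) ∧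
      (∀ θ, ∀ t ∈ Icc 0 L, g (o + t • u θ) = c → t = rad θ) ∧
      (∀ θ, ∀ t ∈ Icc 0 L, t < rad θ → c < g (o + t • u θ)) ∧
      (∀ θ, ∀ t ∈ Icc 0 L, rad θ < t → g (o + t • u θ) < c) := by
  have hgd : Differentiable ℝ g := hg.differentiable two_ne_zero
  obtain ⟨rad, hradI, hradc, hslope, huniq, hbefore, hafter⟩ := exists_radialRoot hg hu hL hconc hball hc0 hcL
  have hdiff : ∀ θ, DifferentiableAt ℝ rad θ :=
    differentiableAt_radialRoot hg hu hradI hradc (fun θ => (hslope θ).ne) huniq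
  set u' : ℝ → EuclideanSpace ℝ (Fin 3) := fun θ => -Real.sin θ • EuclideanSpace.single 0 1 + Real.cos θ • EuclideanSpace.single 1 1
    with hu'
  have hud : ∀ θ, HasDerivAt u (u' θ) θ := fun θ => by rw [hu']; exact hasDerivAt_dir hu θ
  set σ : ℝ → EuclideanSpace ℝ (Fin 3) := fun θ => o + rad θ • u θ with hσ
  set σ' : ℝ → EuclideanSpace ℝ (Fin 3) := fun θ => deriv rad θ • u θ + rad θ • u' θ with hσ'
  have hσd : ∀ θ, HasDerivAt σ (σ' θ) θ := fun θ => by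
    have h := ((hdiff θ).hasDerivAt.smul (hud θ)).const_add o
    have e : rad θ • u' θ + deriv rad θ • u θ = σ' θ := by rw [hσ', add_comm]
    rw [e] at h
    exact h
  have hσ2 : ∀ θ, σ' θ 2 = 0 := fun θ => by
    have h1 := dir_apply_two hu θ
    have h2 : u' θ 2 = 0 := by rw [hu']; simp
    rw [hσ']
    simp [h1, h2]
  have hσc : ∀ θ, g (σ θ) = c := fun θ => hradc θ
  have htan : ∀ θ, fderiv ℝ g (σ θ) (σ' θ) = 0 := fun θ => by
    have h1 : HasDerivAt (fun t => g (σ t)) (fderiv ℝ g (σ θ) (σ' θ)) θ :=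
      (hgd _).hasFDerivAt.comp_hasDerivAt θ (hσd θ)
    have h2 : HasDerivAt (fun t => g (σ t)) 0 θ := by
      have : (fun t => g (σ t)) = fun _ => c := funext hσc
      rw [this]; exact hasDerivAt_const θ c
    exact h1.unique h2
  have hreg : ∀ θ, fderiv ℝ g (σ θ) (EuclideanSpace.single 0 1) ≠ 0 ∨ fderiv ℝ g (σ θ) (EuclideanSpace.single 1 1) ≠ 0 := by
    intro θ
    by_contra h
    simp only [not_or, ne_eq, not_not] at h
    have := hslope θ
    rw [fderiv_apply_dir hu, h.1, h.2] at this
    simp at this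
  exact ⟨rad, σ, σ', hradI, fun θ => rfl, hσd, hσ2, hσc, htan, hreg, huniq, hbefore, hafter⟩

end Radial

end Summit.NavierStokesRegularity.NavierStokesRegularity.Theorems.PoloidalWindowDoorLrcModEntireMorseLevelRadial

end
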